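import Literature.Computability.Complexity.FoldBricks
import Literature.Computability.Complexity.ListFoldBricks
import Literature.Computability.Complexity.PlumbingBricks
import HarnessLib

/-!
# Fold bricks for the Manders–Adleman machine: powers, replication, prefixes, sums and a sieve in `FP`

Toolkit file (generic; no reference to QUADRATIC CONGRUENCES) in the `FP` string-algebra style of
`BrickAlgebra.lean` / `FoldBricks.lean`, written for the machine half of the discharge of
`isNPComplete_QUADCONGFACT` (Manders–Adleman 1978, §2: "we can obtain all quantities needed
deterministically within polynomial time … we can afford to sieve for the primes"). Every brick is a
counted fold `Brick.foldLoop op (Brick.clipF C piece) p` started from a two-field argument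
`⟨v, ruler⟩`, with its value on the intended arguments and its membership in `FP`
(sub-namespace `QuadCongFP`):

* `nthItemFn_encList` — random access `nthItemFn ⟨u, encList l⟩ = l[|u|]` (`ε` past the end),
  through `iterate_sndF_encList`; `onesFn_eq_ones`, `ones_append`, `encodeNat_two_pow`,
  `pow2UF u = ⌜2^{|u|}⌝`, the frame `frm f z = ⟨f z, ε⟩`;
* `powUF ⟨u, 1ᵃ⟩ = ⌜⟦u⟧ᵃ⌝` (product fold, `Brick.foldAcc_prodFn`);
* `repUF ⟨v, 1ᵐ⟩ = encList (replicate m v)` and `takeUF ⟨encList l, 1ᵐ⟩ = encList (l.take m)`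
  (`m ≤ |l|`) (concatenation folds, `Brick.foldAcc_appF`);
* the generic folds `catUF C f ⟨v, 1ᵐ⟩ = ccat (j ↦ f ⟨⟨v,1ᵐ⟩, 1ʲ⟩) m` and
  `sumUF C f ⟨v, 1ᵐ⟩ = ⌜Σ_{j<m} ⟦f ⟨⟨v,1ᵐ⟩, 1ʲ⟩⟧⌝`, valid when the pieces folded are at most
  `C (|⟨v, 1ᵐ⟩| + 1)` long (`catUF_boolPair`, `sumUF_boolPair`);
* the sieve `scanUF χ ⟨r, ⌜N⌝⟩ = encList` of the numerals `⌜m⌝`, `m = 3, …, N + 2`, passing a one-bit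
  test `χ` (`scanUF_boolPair`, for `N ≤ |⟨r, ⌜N⌝⟩|²`: a countdown of `N` rounds clocked by the square
  of the argument's length, the ruler `r` paying for them).

## References

* K. L. Manders, L. Adleman, *NP-complete decision problems for binary quadratics*, J. Comput.
  System Sci. 16 (1978) 168–184, §2.2 (analysis of computation time).
* S. Arora, B. Barak, *Computational Complexity: A Modern Approach*, CUP 2009, §1.3 (polynomial
  time is closed under composition and polynomially bounded loops), §0.1 (codes of lists).
-/

noncomputable section

namespace Literature.Computability.Complexity

namespace QuadCongFP

open _root_.Computability Polynomial Brick HashBricks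

/-! ### Items of a coded list by index -/

/-- Second projections walk down a coded list (twin of `Brick.sndF_iterate_encList`, `ListBricks.lean`). [folklore] -/
theorem iterate_sndF_encList : ∀ (i : ℕ) (l : List (List Bool)), sndF^[i] (encList l) = encList (l.drop i)
  | 0, l => by simp
  | i + 1, [] => by
    rw [Function.iterate_succ_apply, encList_nil, HashBricks.sndF_nil, List.drop_nil]
    have h := iterate_sndF_encList i []
    rwa [encList_nil, List.drop_nil] at h
  | i + 1, a :: l => by
    rw [Function.iterate_succ_apply, encList_cons, sndF_boolPair, iterate_sndF_encList i l]; rfl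

/-- The head item of a coded list (`ε` for the empty list; twin of `Brick.fstF_encList`, `ListBricks.lean`, whose
loop toolkit is not imported here). [folklore] -/
theorem fstF_encList (l : List (List Bool)) : fstF (encList l) = l.headD [] := by
  cases l with
  | nil => simp
  | cons a l => rw [encList_cons, fstF_boolPair]; rfl

/-- **Random access**: `nthItemFn ⟨u, encList l⟩ = l[|u|]` (`ε` past the end). [folklore] -/
theorem nthItemFn_encList (u : List Bool) (l : List (List Bool)) :
    nthItemFn (boolPair u (encList l)) = l.getD u.length [] := by
  rw [nthItemFn_boolPair, iterate_sndF_encList, fstF_encList, List.getD_eq_getElem?_getD,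
    List.headD_eq_head?_getD, List.head?_drop]

/-! ### Unary words, framing, powers of two -/

/-- `onesFn w = 1^{|w|}` (twin of `Ladder3.unaryEncodeNat_eq_ones'`, `CondRed.onesFn_eq_ones`, outside this cone). [folklore] -/
theorem onesFn_eq_ones (w : List Bool) : onesFn w = ones w.length := by
  rw [onesFn]
  induction w.length with
  | zero => rfl
  | succ n ih => rw [show ones (n + 1) = true :: ones n from rfl, ← ih]; rfl

/-- `1ᵐ 1ⁿ = 1ᵐ⁺ⁿ` (twin of the tree's `Com.ones_append`, in `rw` form). [folklore] -/
theorem ones_append (m n : ℕ) : ones m ++ ones n = ones (m + n) :=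
  (List.replicate_add m n true).symm


/-- `frm f z = ⟨f z, ε⟩`: the one-item list code of a value (twin of `Ladder3.frameF`, kept local to
avoid that import). [folklore] -/
def frm (f : List Bool → List Bool) : List Bool → List Bool := fanoutFn f fun _ => []

/-- Value of `frm`. [folklore] -/
@[simp] theorem frm_apply (f : List Bool → List Bool) (z : List Bool) : frm f z = boolPair (f z) [] :=
  fanoutFn_apply _ _ _

/-- `frm f ∈ FP`. [folklore] -/
theorem frm_mem_FP {f : List Bool → List Bool} (hf : f ∈ FP) : frm f ∈ FP := fanoutFn_mem_FP hf (const_mem_FP _)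

/-- `|frm f z| = 2 |f z| + 2`. [folklore] -/
theorem length_frm (f : List Bool → List Bool) (z : List Bool) : (frm f z).length = 2 * (f z).length + 2 := by
  rw [frm_apply, length_boolPair]; rfl

/-- The numeral of `2^W` (twin of `Com.encodeNat_two_pow`, `StackWordArith.lean`, and `TavRecode.encodeNat_two_pow`;
neither file is in this import cone). [folklore] -/
theorem encodeNat_two_pow (W : ℕ) : encodeNat (2 ^ W) = List.replicate W false ++ [true] := by
  refine (eq_of_bitsToNat_eq_of_canonical _ _ (encodeNat_canonical _) (Or.inr ⟨_, rfl⟩) ?_)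
  rw [bitsToNat_encodeNat, bitsToNat_append]; simp

/-- **`pow2UF u = ⌜2^{|u|}⌝`** (`0^{|u|} 1`; same construction as `ConeSim.pow2UF` of
`QuantumComplexity/ConeSimLoop.lean`, not importable into `Complexity/`). [folklore] -/
def pow2UF : List Bool → List Bool := fun u => Kannan.zerosFn u ++ [true]

/-- Value of `pow2UF`. [folklore] -/
@[simp] theorem pow2UF_apply (u : List Bool) : pow2UF u = encodeNat (2 ^ u.length) := by
  rw [pow2UF, Kannan.zerosFn_apply, encodeNat_two_pow]

/-- `pow2UF ∈ FP`. [folklore] -/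
theorem pow2UF_mem_FP : pow2UF ∈ FP := append_mem_FP Kannan.zerosFn_mem_FP (const_mem_FP _)

/-! ### Counted folds started from a two-field argument `⟨v, ruler⟩` -/

/-- The loop record `⟨z, ⟨⌜|sndF z|⌝, ⟨ε, acc₀⟩⟩⟩` of a fold over `|ruler|` rounds with context the
whole argument `z = ⟨v, ruler⟩`. [folklore] -/
def initU (acc₀ : List Bool) : List Bool → List Bool :=
  fanoutFn id (fanoutFn (lenBinF ∘ sndF) (fanoutFn (fun _ => []) (fun _ => acc₀)))

/-- Value of `initU`. [folklore] -/
@[simp] theorem initU_apply (acc₀ v r : List Bool) :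
    initU acc₀ (boolPair v r) = boolPair (boolPair v r) (boolPair (encodeNat r.length) (boolPair (ones 0) acc₀)) := by
  simp [initU, fanoutFn_apply, ones]

/-- `initU acc₀ ∈ FP`. [folklore] -/
theorem initU_mem_FP (acc₀ : List Bool) : initU acc₀ ∈ FP :=
  fanoutFn_mem_FP OracleCompose.id_mem_FP (fanoutFn_mem_FP (comp_mem_FP lenBinF_mem_FP sndF_mem_FP)
    (fanoutFn_mem_FP (const_mem_FP _) (const_mem_FP _)))

/-- The number of rounds `m` is affordable: `m ≤ X (|⟨v, 1ᵐ⟩|)`. [folklore] -/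
theorem rounds_le (v : List Bool) (m : ℕ) : m ≤ (X : Polynomial ℕ).eval (boolPair v (ones m)).length := by
  rw [eval_X, length_boolPair, List.length_replicate]; omega

/-- `encList` of a concatenation (twin of `Ladder3.encList_append` / `Brick.encList_append` of `CyclicListBricks.lean`,
outside this import cone). [folklore] -/
theorem encList_append' : ∀ l₁ l₂ : List (List Bool), encList (l₁ ++ l₂) = encList l₁ ++ encList l₂
  | [], l₂ => by simp
  | a :: l₁, l₂ => by
    rw [List.cons_append, encList_cons, encList_cons, encList_append' l₁ l₂]
    simp [boolPair, List.append_assoc]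

/-- The code of a singleton list is a frame (twin of `Boards.encList_singleton`). [folklore] -/
theorem encList_singleton (a : List Bool) : encList [a] = boolPair a [] := by
  rw [encList_cons, encList_nil]

/-! ### Powers by a unary exponent -/

/-- The piece of the power fold: the base, read off the context `⟨⟨base, ruler⟩, 1ʲ⟩`. [folklore] -/
def basePiece : List Bool → List Bool := fstF ∘ fstF

/-- **`powUF ⟨u, 1ᵃ⟩ = ⌜⟦u⟧ᵃ⌝`**: `a` rounds of the product fold (`Brick.foldAcc_prodFn`).
[cite: AroraBarak2009, §1.3 (bounded loops)] -/
def powUF : List Bool → List Bool := sndPow 2 ∘ foldLoop prodFn (clipF 1 basePiece) X ∘ initU [true]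

/-- `powUF ∈ FP`. [cite: AroraBarak2009, §1.3] -/
theorem powUF_mem_FP : powUF ∈ FP :=
  comp_mem_FP (sndPow_mem_FP 2) (comp_mem_FP
    (foldLoop_clipF_mem_FP 1 prodFn_mem_FP length_prodFn_le (comp_mem_FP fstF_mem_FP fstF_mem_FP) X) (initU_mem_FP _))

/-- **Value of `powUF`.** [folklore] -/
@[simp] theorem powUF_boolPair (u : List Bool) (a : ℕ) : powUF (boolPair u (ones a)) = encodeNat (bitsToNat u ^ a) := by
  rw [powUF, Function.comp_apply, Function.comp_apply, initU_apply, List.length_replicate,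
    foldLoop_apply _ _ (rounds_le u a) 0 [true]]
  simp only [sndPow, Function.comp_apply, sndF_boolPair]
  rw [foldAcc_clipF (fun j _ _ => by simp [basePiece]; omega), show [true] = encodeNat 1 from rfl, foldAcc_prodFn]
  simp [basePiece]

/-! ### Replication -/

/-- **`repUF ⟨v, 1ᵐ⟩ = encList (replicate m v)`**: `m` rounds of the concatenation fold emitting the
frame `⟨v, ε⟩`. [cite: AroraBarak2009, §1.3 (bounded loops)] -/
def repUF : List Bool → List Bool := sndPow 2 ∘ foldLoop appF (clipF 1 (frm basePiece)) X ∘ initU []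

/-- `repUF ∈ FP`. [cite: AroraBarak2009, §1.3] -/
theorem repUF_mem_FP : repUF ∈ FP :=
  comp_mem_FP (sndPow_mem_FP 2) (comp_mem_FP
    (foldLoop_clipF_mem_FP 1 appF_mem_FP length_appF_le (frm_mem_FP (comp_mem_FP fstF_mem_FP fstF_mem_FP)) X)
    (initU_mem_FP _))

/-- A concatenation of `m` equal frames is the code of a constant list. [folklore] -/
theorem ccat_const_frame (v : List Bool) : ∀ m : ℕ, ccat (fun _ => boolPair v []) m = encList (List.replicate m v)
  | 0 => rfl
  | m + 1 => by
    rw [ccat_succ, ccat_const_frame v m, List.replicate_succ', encList_append', encList_singleton]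

/-- **Value of `repUF`.** [folklore] -/
@[simp] theorem repUF_boolPair (v : List Bool) (m : ℕ) : repUF (boolPair v (ones m)) = encList (List.replicate m v) := by
  rw [repUF, Function.comp_apply, Function.comp_apply, initU_apply, List.length_replicate,
    foldLoop_apply _ _ (rounds_le v m) 0 []]
  simp only [sndPow, Function.comp_apply, sndF_boolPair]
  rw [foldAcc_clipF (fun j _ _ => by rw [length_frm, length_boolPair]; simp [basePiece]; omega), foldAcc_appF]
  simp [basePiece, ccat_const_frame]

/-! ### Taking a prefix of a coded list -/

/-- The piece of the prefix fold: the frame of item `j` of the list `v` of the context `⟨⟨v, r⟩, 1ʲ⟩`. [folklore] -/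
def takePiece : List Bool → List Bool := frm (nthItemFn ∘ fanoutFn sndF (fstF ∘ fstF))

/-- `takePiece ∈ FP`. [folklore] -/
theorem takePiece_mem_FP : takePiece ∈ FP :=
  frm_mem_FP (comp_mem_FP nthItemFn_mem_FP (fanoutFn_mem_FP sndF_mem_FP (comp_mem_FP fstF_mem_FP fstF_mem_FP)))

/-- Value of `takePiece` on a coded list. [folklore] -/
theorem takePiece_apply (l : List (List Bool)) (r : List Bool) (j : ℕ) :
    takePiece (boolPair (boolPair (encList l) r) (ones j)) = boolPair (l.getD j []) [] := by
  simp [takePiece, fanoutFn_apply, nthItemFn_encList]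

/-- **`takeUF ⟨encList l, 1ᵐ⟩ = encList (l.take m)`** for `m ≤ |l|`. [cite: AroraBarak2009, §1.3 (bounded loops)] -/
def takeUF : List Bool → List Bool := sndPow 2 ∘ foldLoop appF (clipF 2 takePiece) X ∘ initU []

/-- `takeUF ∈ FP`. [cite: AroraBarak2009, §1.3] -/
theorem takeUF_mem_FP : takeUF ∈ FP :=
  comp_mem_FP (sndPow_mem_FP 2) (comp_mem_FP (foldLoop_clipF_mem_FP 2 appF_mem_FP length_appF_le takePiece_mem_FP X)
    (initU_mem_FP _))

/-- A concatenation of the frames of the first `m ≤ |l|` items is the code of the prefix. [folklore] -/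
theorem ccat_frame_getD (l : List (List Bool)) : ∀ m : ℕ, m ≤ l.length →
    ccat (fun j => boolPair (l.getD j []) []) m = encList (l.take m)
  | 0, _ => rfl
  | m + 1, h => by
    rw [ccat_succ, ccat_frame_getD l m (by omega), List.take_add_one, encList_append', List.getD_eq_getElem _ _ h,
      List.getElem?_eq_getElem h, Option.toList_some, encList_singleton]

/-- An item of a coded list is at most half as long as the code. [folklore] -/
theorem two_mul_length_getD_le (l : List (List Bool)) (j : ℕ) : 2 * (l.getD j []).length ≤ (encList l).length := by
  by_cases hj : j < l.length
  · have hm : l.getD j [] ∈ decNil (encList l) := by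
      rw [decNil_encList, List.getD_eq_getElem _ _ hj]; exact List.getElem_mem hj
    exact two_mul_length_le_of_mem_decNil hm
  · rw [List.getD_eq_default _ _ (by omega)]; simp

/-- **Value of `takeUF`.** [folklore] -/
theorem takeUF_boolPair {l : List (List Bool)} {m : ℕ} (h : m ≤ l.length) :
    takeUF (boolPair (encList l) (ones m)) = encList (l.take m) := by
  rw [takeUF, Function.comp_apply, Function.comp_apply, initU_apply, List.length_replicate,
    foldLoop_apply _ _ (rounds_le (encList l) m) 0 []]
  simp only [sndPow, Function.comp_apply, sndF_boolPair]
  rw [foldAcc_clipF (fun j _ _ => by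
    rw [takePiece, length_frm, length_boolPair]
    have h1 : (nthItemFn ∘ fanoutFn sndF (fstF ∘ fstF)) (boolPair (boolPair (encList l) (ones m)) (ones j)) = l.getD j [] := by
      simp [fanoutFn_apply, nthItemFn_encList]
    rw [h1]; have := two_mul_length_getD_le l j; omega), foldAcc_appF]
  simp only [zero_add, takePiece_apply, List.nil_append]
  exact ccat_frame_getD l m h

/-! ### Generic concatenation and sum folds over `|ruler|` rounds -/

/-- **`catUF C f ⟨v, 1ᵐ⟩`**: the concatenation of the pieces `f ⟨⟨v, 1ᵐ⟩, 1ʲ⟩`, `j < m` (pieces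
clipped to `C (|⟨v, 1ᵐ⟩| + 1)` symbols). [cite: AroraBarak2009, §1.3 (bounded loops)] -/
def catUF (C : ℕ) (f : List Bool → List Bool) : List Bool → List Bool :=
  sndPow 2 ∘ foldLoop appF (clipF C f) X ∘ initU []

/-- `catUF C f ∈ FP` for `f ∈ FP`. [cite: AroraBarak2009, §1.3] -/
theorem catUF_mem_FP (C : ℕ) {f : List Bool → List Bool} (hf : f ∈ FP) : catUF C f ∈ FP :=
  comp_mem_FP (sndPow_mem_FP 2) (comp_mem_FP (foldLoop_clipF_mem_FP C appF_mem_FP length_appF_le hf X) (initU_mem_FP _))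

/-- **Value of `catUF`** when the pieces are short. [folklore] -/
theorem catUF_boolPair {C : ℕ} {f : List Bool → List Bool} {v : List Bool} {m : ℕ}
    (hf : ∀ j < m, (f (boolPair (boolPair v (ones m)) (ones j))).length ≤ C * ((boolPair v (ones m)).length + 1)) :
    catUF C f (boolPair v (ones m)) = ccat (fun j => f (boolPair (boolPair v (ones m)) (ones j))) m := by
  rw [catUF, Function.comp_apply, Function.comp_apply, initU_apply, List.length_replicate,
    foldLoop_apply _ _ (rounds_le v m) 0 []]
  simp only [sndPow, Function.comp_apply, sndF_boolPair]
  rw [foldAcc_clipF (fun j _ hj => hf j (by omega)), foldAcc_appF]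
  simp

/-- **`sumUF C f ⟨v, 1ᵐ⟩ = ⌜Σ_{j<m} ⟦f ⟨⟨v, 1ᵐ⟩, 1ʲ⟩⟧⌝`** (pieces clipped to `C (|⟨v, 1ᵐ⟩| + 1)`
symbols). [cite: AroraBarak2009, §1.3 (bounded loops)] -/
def sumUF (C : ℕ) (f : List Bool → List Bool) : List Bool → List Bool :=
  sndPow 2 ∘ foldLoop addFn (clipF C f) X ∘ initU []

/-- `sumUF C f ∈ FP` for `f ∈ FP`. [cite: AroraBarak2009, §1.3] -/
theorem sumUF_mem_FP (C : ℕ) {f : List Bool → List Bool} (hf : f ∈ FP) : sumUF C f ∈ FP :=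
  comp_mem_FP (sndPow_mem_FP 2) (comp_mem_FP (foldLoop_clipF_mem_FP C addFn_mem_FP length_addFn_le hf X) (initU_mem_FP _))

/-- **Value of `sumUF`** when the pieces are short. [folklore] -/
theorem sumUF_boolPair {C : ℕ} {f : List Bool → List Bool} {v : List Bool} {m : ℕ}
    (hf : ∀ j < m, (f (boolPair (boolPair v (ones m)) (ones j))).length ≤ C * ((boolPair v (ones m)).length + 1)) :
    sumUF C f (boolPair v (ones m)) =
      encodeNat (∑ j ∈ Finset.range m, bitsToNat (f (boolPair (boolPair v (ones m)) (ones j)))) := by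
  rw [sumUF, Function.comp_apply, Function.comp_apply, initU_apply, List.length_replicate,
    foldLoop_apply _ _ (rounds_le v m) 0 []]
  simp only [sndPow, Function.comp_apply, sndF_boolPair]
  rw [foldAcc_clipF (fun j _ hj => hf j (by omega)), show ([] : List Bool) = encodeNat 0 from rfl, foldAcc_addFn]
  simp

/-! ### Sieving numerals: the items `⌜m⌝`, `3 ≤ m < N + 3`, passing a one-bit test -/

/-- The candidate `⌜j + 3⌝` on `⟨x, 1ʲ⟩` (cf. `ShorFP.candF`, a different candidate map). [folklore] -/
def candF : List Bool → List Bool := addFn ∘ fanoutFn (lenBinF ∘ sndF) (fun _ => encodeNat 3)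

/-- `candF ∈ FP`. [folklore] -/
theorem candF_mem_FP : candF ∈ FP :=
  comp_mem_FP addFn_mem_FP (fanoutFn_mem_FP (comp_mem_FP lenBinF_mem_FP sndF_mem_FP) (const_mem_FP _))

/-- Value of `candF`. [folklore] -/
@[simp] theorem candF_boolPair (x : List Bool) (j : ℕ) : candF (boolPair x (ones j)) = encodeNat (j + 3) := by
  simp [candF, fanoutFn_apply]

/-- The scan piece: the frame `⟨⌜j+3⌝, ε⟩` if `χ ⌜j+3⌝ = 1`, else `ε`. [folklore] -/
def scanPiece (χ : List Bool → List Bool) : List Bool → List Bool := iteFn (χ ∘ candF) (frm candF) fun _ => []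

/-- `scanPiece χ ∈ FP` for `χ ∈ FP`. [folklore] -/
theorem scanPiece_mem_FP {χ : List Bool → List Bool} (hχ : χ ∈ FP) : scanPiece χ ∈ FP :=
  iteFn_mem_FP (comp_mem_FP hχ candF_mem_FP) (frm_mem_FP candF_mem_FP) (const_mem_FP _)

/-- Value of the scan piece, for a one-bit `χ` with `χ ⌜m⌝ = [P m]`. [folklore] -/
theorem scanPiece_boolPair {χ : List Bool → List Bool} {P : ℕ → Bool} (hχ : ∀ m, χ (encodeNat m) = [P m])
    (x : List Bool) (j : ℕ) :
    scanPiece χ (boolPair x (ones j)) = if P (j + 3) then boolPair (encodeNat (j + 3)) [] else [] := by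
  have hc : (χ ∘ candF) (boolPair x (ones j)) = [P (j + 3)] := by rw [Function.comp_apply, candF_boolPair, hχ]
  rw [scanPiece, iteFn_apply hc]
  cases P (j + 3) <;> simp

/-- The loop record of the scan on `z = ⟨r, ⌜N⌝⟩`: context `z`, countdown `⌜N⌝`. [folklore] -/
def scanInit : List Bool → List Bool := fanoutFn id (fanoutFn sndF (fanoutFn (fun _ => []) (fun _ => [])))

/-- `scanInit ∈ FP`. [folklore] -/
theorem scanInit_mem_FP : scanInit ∈ FP :=
  fanoutFn_mem_FP OracleCompose.id_mem_FP (fanoutFn_mem_FP sndF_mem_FP (fanoutFn_mem_FP (const_mem_FP _) (const_mem_FP _)))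

/-- **`scanUF χ ⟨r, ⌜N⌝⟩`**: the coded list of the numerals `⌜m⌝`, `m = 3, 4, …, N + 2` in increasing
order, that pass `χ` — a countdown of `N` rounds clocked by `|⟨r, ⌜N⌝⟩|²` (the ruler `r` pays for the
rounds: `N ≤ |⟨r, ⌜N⌝⟩|²` is required). With `χ` the indicator of `PRIMES` this sieves the primes
("we can afford to sieve for the primes"). [cite: MandersAdleman1978, §2.2] -/
def scanUF (χ : List Bool → List Bool) : List Bool → List Bool :=
  sndPow 2 ∘ foldLoop appF (clipF 4 (scanPiece χ)) (X ^ 2) ∘ scanInit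

/-- `scanUF χ ∈ FP` for `χ ∈ FP`. [cite: AroraBarak2009, §1.3] -/
theorem scanUF_mem_FP {χ : List Bool → List Bool} (hχ : χ ∈ FP) : scanUF χ ∈ FP :=
  comp_mem_FP (sndPow_mem_FP 2) (comp_mem_FP (foldLoop_clipF_mem_FP 4 appF_mem_FP length_appF_le (scanPiece_mem_FP hχ) _)
    scanInit_mem_FP)

/-- A concatenation of conditional frames is the code of the filtered list. [folklore] -/
theorem ccat_ite_frame (P : ℕ → Bool) : ∀ N : ℕ,
    ccat (fun j => if P (j + 3) then boolPair (encodeNat (j + 3)) [] else []) N =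
      encList (((List.range' 3 N).filter P).map encodeNat)
  | 0 => rfl
  | N + 1 => by
    rw [ccat_succ, ccat_ite_frame P N, List.range'_concat, List.filter_append, List.map_append, encList_append']
    congr 1
    rw [show 3 + 1 * N = N + 3 from by ring, List.filter_singleton]
    cases P (N + 3) <;> simp [encList_singleton]

/-- `size (j + 3) ≤ size N + 2` for `j < N`. [folklore] -/
theorem size_add_three_le {j N : ℕ} (hj : j < N) : (j + 3).size ≤ N.size + 2 := by
  rw [Nat.size_le]
  have h := Nat.lt_size_self N
  calc j + 3 ≤ N + 2 := by omega
    _ < 2 ^ N.size * 4 := by omega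
    _ = 2 ^ (N.size + 2) := by rw [pow_add]; norm_num

/-- **Value of `scanUF`.** [folklore] -/
theorem scanUF_boolPair {χ : List Bool → List Bool} {P : ℕ → Bool} (hχ : ∀ m, χ (encodeNat m) = [P m])
    {r : List Bool} {N : ℕ} (hN : N ≤ (boolPair r (encodeNat N)).length ^ 2) :
    scanUF χ (boolPair r (encodeNat N)) = encList (((List.range' 3 N).filter P).map encodeNat) := by
  rw [scanUF, Function.comp_apply, Function.comp_apply]
  have hinit : scanInit (boolPair r (encodeNat N)) =
      boolPair (boolPair r (encodeNat N)) (boolPair (encodeNat N) (boolPair (ones 0) [])) := by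
    simp [scanInit, fanoutFn_apply, ones]
  rw [hinit, foldLoop_apply _ _ (by rwa [eval_pow, eval_X]) 0 []]
  simp only [sndPow, Function.comp_apply, sndF_boolPair]
  rw [foldAcc_clipF (fun j _ hj => by
    rw [scanPiece_boolPair hχ]
    have h1 : (encodeNat (j + 3)).length ≤ N.size + 2 := by
      rw [TM2Pass.length_encodeNat_eq_size]; exact size_add_three_le (by omega)
    have h2 : N.size + 2 ≤ (boolPair r (encodeNat N)).length := by
      rw [length_boolPair, TM2Pass.length_encodeNat_eq_size]; omega
    cases P (j + 3)
    · simp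
    · rw [if_pos rfl, length_boolPair (encodeNat (j + 3)) [], List.length_nil]; omega), foldAcc_appF]
  simp only [zero_add, List.nil_append, scanPiece_boolPair hχ]
  exact ccat_ite_frame P N

end QuadCongFP

end Literature.Computability.Complexity

end
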